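import Summits.Ventures.PercRepro.S1CoreCapEightFourTri
import Summits.Ventures.PercRepro.S1CoreCapEightFourNT3
import Summits.Ventures.PercRepro.S1CoreCapEightFive
import Summits.Ventures.PercRepro.S1CoreCapEightCases

/-!
# PercRepro — `FourBigBound₈` IS A THEOREM (p1, gen 27)

Four distinct lines of `≥ 4` points at nullity `8`: a fifth is impossible (`not_five_big`), so every other line
has three points; the four are simple, fat-free, and every other line is a fat-free transversal inside their
union (`four_big_data`, from `S1CoreCapEightFour`). If no three of them pairwise meet in distinct points
(`NoTriangle`) there is no other line at all and the cap is `16` (`four_big_bound_of_no_triangle`, from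
`no_transversal_of_no_triangle`); otherwise some triple `M, N, O` has `lineRank [O, N, M] ≤ 3`
(`lineRank_le_three_of_triangle`) and the cap is `≤ 23` (`four_big_bound_of_triangle`, with the fourth line
found by a pigeonhole). Hence `fourBigBound₈_holds : FourBigBound₈`, and the crude instance reads
`fourCapSpec_eight_of_threeBig : ThreeBigNonplanarBound₈ → FourCapSpec capPaper 8 25`.
`proofs/P1-S4-CAPBRIDGE.md` §19. Axioms: standard.
-/

namespace PercRepro

namespace S1

namespace FourCap

namespace Eight

open Seven

variable {β : Type} [DecidableEq β]

section All

variable {w : β → ℕ} {ls : Finset (Finset β)}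
  (h1 : ∀ L ∈ ls, ∀ v ∈ L, w v = 1 ∨ w v = 2)
  (h2 : ∀ L ∈ ls, 3 ≤ L.card ∧ wsum w L ≤ 5)
  (h3 : ∀ L ∈ ls, ∀ L' ∈ ls, L ≠ L' → (L ∩ L').card ≤ 1)
  (h4 : ∀ l : List (Finset β), l.Nodup → (∀ L ∈ l, L ∈ ls) → wsum w (unionL l) ≤ 8 + lineRank l)
  (h5 : ∀ l : List (Finset β), l.Nodup → (∀ L ∈ l, L ∈ ls) → lineRank l ≤ 3 → (unionL l).card ≤ 9)

include h1 h2 h3 h4 h5 in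
/-- **The data of four big lines**: all four have four points, every line of the configuration is fat-free, and
every other 3-point line lies inside the union of the four. -/
theorem four_big_data {L₁ L₂ L₃ L₄ : Finset β} (hL₁ : L₁ ∈ ls) (hL₂ : L₂ ∈ ls) (hL₃ : L₃ ∈ ls)
    (hL₄ : L₄ ∈ ls) (h12 : L₂ ≠ L₁) (h13 : L₃ ≠ L₁) (h14 : L₄ ≠ L₁) (h23 : L₃ ≠ L₂) (h24 : L₄ ≠ L₂)
    (h34 : L₄ ≠ L₃) (c1 : 4 ≤ L₁.card) (c2 : 4 ≤ L₂.card) (c3 : 4 ≤ L₃.card) (c4 : 4 ≤ L₄.card)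
    (hrest : ∀ L ∈ ls, L ≠ L₁ → L ≠ L₂ → L ≠ L₃ → L ≠ L₄ → L.card = 3) :
    L₁.card = 4 ∧ L₂.card = 4 ∧ L₃.card = 4 ∧ L₄.card = 4 ∧ (∀ L ∈ ls, fat w L = 0) ∧
      (∀ L ∈ ls, L ≠ L₁ → L ≠ L₂ → L ≠ L₃ → L ≠ L₄ → L ⊆ L₄ ∪ (L₃ ∪ (L₂ ∪ L₁))) := by
  have key : ∀ (A B C D : Finset β), A ∈ ls → B ∈ ls → C ∈ ls → D ∈ ls → B ≠ A → C ≠ A → D ≠ A → C ≠ B →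
      D ≠ B → D ≠ C → 4 ≤ A.card → 4 ≤ B.card → 4 ≤ C.card → 4 ≤ D.card →
      (∀ L ∈ ls, L ≠ A → L ≠ B → L ≠ C → L ≠ D → L.card = 3) →
      (D ∩ (C ∪ (B ∪ A))).card ≤ 2 →
      A.card = 4 ∧ B.card = 4 ∧ C.card = 4 ∧ D.card = 4 ∧ (∀ L ∈ ls, fat w L = 0) ∧
        (∀ L ∈ ls, L ≠ A → L ≠ B → L ≠ C → L ≠ D → L ⊆ D ∪ (C ∪ (B ∪ A))) := by
    intro A B C D hA hB hC hD hBA hCA hDA hCB hDB hDC cA cB cC cD hr hlast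
    obtain ⟨kA, kB, kC, kD, hf, hcost⟩ := four_big_simple h1 h2 h3 h4 hA hB hC hD hBA hCA hDA hCB hDB hDC
      cA cB cC cD hlast
    refine ⟨kA, kB, kC, kD, fun L hL => ?_, fun L hL hLA hLB hLC hLD =>
      (covered_of_four_big h1 h2 h4 hA hB hC hD hBA hCA hDA hCB hDB hDC hcost hf hL hLA hLB hLC hLD
        (hr L hL hLA hLB hLC hLD)).1⟩
    by_cases hLA : L = A
    · subst hLA; exact le_antisymm (le_trans (fat_mono w (Finset.subset_union_right.trans
        (Finset.subset_union_right.trans Finset.subset_union_right))) hf.le) (Nat.zero_le _)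
    by_cases hLB : L = B
    · subst hLB; exact le_antisymm (le_trans (fat_mono w (Finset.subset_union_left.trans
        (Finset.subset_union_right.trans Finset.subset_union_right))) hf.le) (Nat.zero_le _)
    by_cases hLC : L = C
    · subst hLC; exact le_antisymm (le_trans (fat_mono w (Finset.subset_union_left.trans
        Finset.subset_union_right)) hf.le) (Nat.zero_le _)
    by_cases hLD : L = D
    · subst hLD; exact le_antisymm (le_trans (fat_mono w Finset.subset_union_left) hf.le) (Nat.zero_le _)
    exact (covered_of_four_big h1 h2 h4 hA hB hC hD hBA hCA hDA hCB hDB hDC hcost hf hL hLA hLB hLC hLD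
      (hr L hL hLA hLB hLC hLD)).2
  rcases exists_last_le_two h3 h5 hL₁ hL₂ hL₃ hL₄ h12 h13 h14 h23 h24 h34 c1 c2 c3 c4 with h | h | h
  · exact key L₁ L₂ L₃ L₄ hL₁ hL₂ hL₃ hL₄ h12 h13 h14 h23 h24 h34 c1 c2 c3 c4 hrest h
  · obtain ⟨k1, k2, k4, k3, hf, hsub⟩ := key L₁ L₂ L₄ L₃ hL₁ hL₂ hL₄ hL₃ h12 h14 h13 h24 h23 h34.symm c1 c2 c4
      c3 (fun L hL a b c d => hrest L hL a b d c) h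
    refine ⟨k1, k2, k3, k4, hf, fun L hL a b c d => ?_⟩
    rw [show L₄ ∪ (L₃ ∪ (L₂ ∪ L₁)) = L₃ ∪ (L₄ ∪ (L₂ ∪ L₁)) by ac_rfl]
    exact hsub L hL a b d c
  · obtain ⟨k1, k3, k4, k2, hf, hsub⟩ := key L₁ L₃ L₄ L₂ hL₁ hL₃ hL₄ hL₂ h13 h14 h12 h34 h23.symm h24.symm c1 c3
      c4 c2 (fun L hL a b c d => hrest L hL a d b c) h
    refine ⟨k1, k2, k3, k4, hf, fun L hL a b c d => ?_⟩
    rw [show L₄ ∪ (L₃ ∪ (L₂ ∪ L₁)) = L₂ ∪ (L₄ ∪ (L₃ ∪ L₁)) by ac_rfl]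
    exact hsub L hL a c d b

include h1 h2 h3 h4 h5 in
/-- **Four big lines without a triangle: cap sum `= 16`** (there is no other line). -/
theorem four_big_bound_of_no_triangle (hnt : NoTriangle ls) {L₁ L₂ L₃ L₄ : Finset β} (hL₁ : L₁ ∈ ls)
    (hL₂ : L₂ ∈ ls) (hL₃ : L₃ ∈ ls) (hL₄ : L₄ ∈ ls) (h12 : L₂ ≠ L₁) (h13 : L₃ ≠ L₁) (h14 : L₄ ≠ L₁)
    (h23 : L₃ ≠ L₂) (h24 : L₄ ≠ L₂) (h34 : L₄ ≠ L₃) (c1 : 4 ≤ L₁.card) (c2 : 4 ≤ L₂.card) (c3 : 4 ≤ L₃.card)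
    (c4 : 4 ≤ L₄.card) (hrest : ∀ L ∈ ls, L ≠ L₁ → L ≠ L₂ → L ≠ L₃ → L ≠ L₄ → L.card = 3) :
    ∑ L ∈ ls, capPaper L.card (fat w L) ≤ 16 := by
  obtain ⟨k1, k2, k3, k4, hf, hsub⟩ := four_big_data h1 h2 h3 h4 h5 hL₁ hL₂ hL₃ hL₄ h12 h13 h14 h23 h24 h34 c1
    c2 c3 c4 hrest
  -- every line is one of the four
  have hall : ls ⊆ {L₁, L₂, L₃, L₄} := by
    intro L hL
    by_contra hne
    simp only [Finset.mem_insert, Finset.mem_singleton, not_or] at hne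
    obtain ⟨n1, n2, n3, n4⟩ := hne
    exact no_transversal_of_no_triangle h1 h2 h3 h4 hnt hL hL₁ hL₂ hL₃ hL₄ (Ne.symm n1) (Ne.symm n2)
      (Ne.symm n3) (Ne.symm n4) h12 h13 h14 h23 h24 h34 (hrest L hL n1 n2 n3 n4) (hf L hL) k1 k2 k3 k4
      (hf L₁ hL₁) (hf L₂ hL₂) (hf L₃ hL₃) (hf L₄ hL₄) (hsub L hL n1 n2 n3 n4)
  have hcap : ∀ L ∈ ls, capPaper L.card (fat w L) ≤ 4 := by
    intro L hL
    have := hall hL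
    simp only [Finset.mem_insert, Finset.mem_singleton] at this
    obtain ⟨-, c40, -⟩ := capPaper_values
    rcases this with rfl | rfl | rfl | rfl
    · rw [k1, hf L hL, c40]
    · rw [k2, hf L hL, c40]
    · rw [k3, hf L hL, c40]
    · rw [k4, hf L hL, c40]
  calc ∑ L ∈ ls, capPaper L.card (fat w L) ≤ ∑ _L ∈ ls, 4 := Finset.sum_le_sum hcap
    _ = ls.card * 4 := Finset.sum_const_nat (fun _ _ => rfl)
    _ ≤ 4 * 4 := by
        have := Finset.card_le_card hall
        have h4c : ({L₁, L₂, L₃, L₄} : Finset (Finset β)).card ≤ 4 := Finset.card_le_four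
        omega

/-- **The rank bridge**: three big lines with `|N ∩ M| = 1` and `2 ≤ |O ∩ (N ∪ M)|` have
`lineRank [O, N, M] ≤ 3`. -/
theorem lineRank_le_three_of_triangle {M N O : Finset β} (cN : 4 ≤ N.card) (cO : 4 ≤ O.card)
    (hNM : (N ∩ M).card = 1) (hO : 2 ≤ (O ∩ (N ∪ M)).card)
    (hO' : (O ∩ (N ∪ M)).card ≤ 2) : lineRank [O, N, M] ≤ 3 := by
  have sN := Finset.card_sdiff_add_card_inter N M
  have sO := Finset.card_sdiff_add_card_inter O (N ∪ M)
  simp only [lineRank, unionL, Finset.union_empty, Finset.sdiff_empty, Finset.inter_empty, Finset.card_empty,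
    Nat.zero_add]
  omega

end All

/-- **`FourBigBound₈` holds**: four distinct big lines at nullity `8` give cap sum `≤ 25` (in fact `≤ 23`). -/
theorem fourBigBound₈_holds : FourBigBound₈ := by
  intro β _ w ls h1 h2 h3 h4 h5 h6 L₁ L₂ L₃ L₄ hL₁ hL₂ hL₃ hL₄ h12 h13 h14 h23 h24 h34 c1 c2 c3 c4
  -- no fifth big line
  have hrest : ∀ L ∈ ls, L ≠ L₁ → L ≠ L₂ → L ≠ L₃ → L ≠ L₄ → L.card = 3 := by
    intro L hL n1 n2 n3 n4
    have := (h2 L hL).1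
    by_contra hne
    exact not_five_big h1 h2 h3 h4 h5 hL₁ hL₂ hL₃ hL₄ hL h12 h13 h14 n1 h23 h24 n2 h34 n3 n4 c1 c2 c3 c4
      (by omega)
  by_cases hnt : NoTriangle ls
  · exact (four_big_bound_of_no_triangle h1 h2 h3 h4 h5 hnt hL₁ hL₂ hL₃ hL₄ h12 h13 h14 h23 h24 h34 c1 c2 c3
      c4 hrest).trans (by norm_num)
  · -- a triangle `M, N, O`
    unfold NoTriangle at hnt
    push Not at hnt
    obtain ⟨M, N, O, hM, hN, hO, cM, cN, cO, hNM, hOM, hON, hNM1, hO2⟩ := hnt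
    have hNM' := h3 N hN M hM hNM
    have hO' : (O ∩ (N ∪ M)).card ≤ 2 := le_trans (card_inter_union_le O N M)
      (by have := h3 O hO N hN hON; have := h3 O hO M hM hOM; omega)
    have hr : lineRank [O, N, M] ≤ 3 := lineRank_le_three_of_triangle cN cO (by omega) (by omega) hO'
    -- every big line is one of the four
    have hbig : ∀ L ∈ ls, 4 ≤ L.card → L = L₁ ∨ L = L₂ ∨ L = L₃ ∨ L = L₄ := by
      intro L hL hc
      by_contra hne
      simp only [not_or] at hne
      have := hrest L hL hne.1 hne.2.1 hne.2.2.1 hne.2.2.2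
      omega
    -- the fourth line `D`
    have hMin : M ∈ ({L₁, L₂, L₃, L₄} : Finset (Finset β)) := by
      simp only [Finset.mem_insert, Finset.mem_singleton]; exact hbig M hM cM
    have hNin : N ∈ ({L₁, L₂, L₃, L₄} : Finset (Finset β)) := by
      simp only [Finset.mem_insert, Finset.mem_singleton]; exact hbig N hN cN
    have hOin : O ∈ ({L₁, L₂, L₃, L₄} : Finset (Finset β)) := by
      simp only [Finset.mem_insert, Finset.mem_singleton]; exact hbig O hO cO
    have hcard4 : ({L₁, L₂, L₃, L₄} : Finset (Finset β)).card = 4 := by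
      rw [Finset.card_insert_of_notMem (by simp [h12.symm, h13.symm, h14.symm]),
        Finset.card_insert_of_notMem (by simp [h23.symm, h24.symm]), Finset.card_pair h34.symm]
    have hcard3 : ({M, N, O} : Finset (Finset β)).card = 3 := by
      rw [Finset.card_insert_of_notMem (by simp [hNM.symm, hOM.symm]), Finset.card_pair hON.symm]
    have hsub3 : ({M, N, O} : Finset (Finset β)) ⊆ {L₁, L₂, L₃, L₄} := by
      intro L hL
      simp only [Finset.mem_insert, Finset.mem_singleton] at hL
      rcases hL with rfl | rfl | rfl
      · exact hMin
      · exact hNin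
      · exact hOin
    obtain ⟨D, hDin, hDnot⟩ : ∃ D ∈ ({L₁, L₂, L₃, L₄} : Finset (Finset β)), D ∉ ({M, N, O} : Finset (Finset β)) := by
      by_contra hc
      push Not at hc
      have := Finset.card_le_card (fun L hL => hc L hL : ({L₁, L₂, L₃, L₄} : Finset (Finset β)) ⊆ {M, N, O})
      omega
    simp only [Finset.mem_insert, Finset.mem_singleton, not_or] at hDnot
    obtain ⟨hDM, hDN, hDO⟩ := hDnot
    have hD : D ∈ ls := by
      simp only [Finset.mem_insert, Finset.mem_singleton] at hDin
      rcases hDin with rfl | rfl | rfl | rfl <;> assumption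
    have cD : 4 ≤ D.card := by
      simp only [Finset.mem_insert, Finset.mem_singleton] at hDin
      rcases hDin with rfl | rfl | rfl | rfl <;> assumption
    -- the other lines have three points
    have hrest' : ∀ L ∈ ls, L ≠ M → L ≠ N → L ≠ O → L ≠ D → L.card = 3 := by
      intro L hL nM nN nO nD
      have h4set : ({M, N, O, D} : Finset (Finset β)) = {L₁, L₂, L₃, L₄} := by
        apply Finset.eq_of_subset_of_card_le
        · intro L' hL'
          simp only [Finset.mem_insert, Finset.mem_singleton] at hL'
          rcases hL' with rfl | rfl | rfl | rfl
          · exact hMin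
          · exact hNin
          · exact hOin
          · exact hDin
        · rw [hcard4, Finset.card_insert_of_notMem (by simp [hNM.symm, hOM.symm, Ne.symm hDM]),
            Finset.card_insert_of_notMem (by simp [hON.symm, Ne.symm hDN]),
            Finset.card_pair (Ne.symm hDO)]
      by_contra hne
      have hLbig : L ∈ ({L₁, L₂, L₃, L₄} : Finset (Finset β)) := by
        simp only [Finset.mem_insert, Finset.mem_singleton]
        exact hbig L hL (by have := (h2 L hL).1; omega)
      rw [← h4set] at hLbig
      simp only [Finset.mem_insert, Finset.mem_singleton] at hLbig
      rcases hLbig with rfl | rfl | rfl | rfl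
      · exact nM rfl
      · exact nN rfl
      · exact nO rfl
      · exact nD rfl
    exact (four_big_bound_of_triangle h1 h2 h3 h4 h5 hM hN hO hD hNM hOM hDM hON hDN hDO cM cN cO cD hrest'
      hr).trans (by norm_num)

/-- **THE INSTANCE `ν = 8` IN CRUDE FORM, MODULO ONE CASE**: `FourCapSpec capPaper 8 25` follows from
`ThreeBigNonplanarBound₈` alone. -/
theorem fourCapSpec_eight_of_threeBig (hA : ThreeBigNonplanarBound₈) : FourCapSpec capPaper 8 25 :=
  fourCapSpec_eight_of hA fourBigBound₈_holds

end Eight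

end FourCap

end S1

end PercRepro
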